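import Literature.NumberTheory.Rogawski1990.ArchChartSlotPermStableClasses        -- part I (this brick): UNIQ-G′, the slot conjugator, finite-order Haar invariance
import Literature.NumberTheory.Rogawski1990.ArchHCOrbitalFamilyG                 -- ★ (LH3-p02) the `G′` junction `classOrbitalIntegral_mul_measure_box_eq_chartOrbG`, `orbFamG`; brings `chartTorusG ∕ chartBoxImgG ∕ chartOrbG`, (CENT-G)
import Literature.NumberTheory.Rogawski1990.ArchChartBoxCoherence                 -- ★ R3 (LH1-p02): `slotPerm_mem_chartBox_iff`, `image_slotPerm_chartBox`
import Literature.NumberTheory.Automorphic.ArchInnerFormChartOrbWeyl               -- ★ (LH3-p02) ED. 2: `measure_chartBoxImgG_pos`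
import Literature.NumberTheory.Rogawski1990.ArchStableSumGClassSum               -- ★ (2) PART 3 (LH10-p02 (g9)) p851944: `stableSumG_eq_archRG_mul_sum` (the class-sum reading of `stableSumG`) — EDITION 2
import HarnessLib

/-!
# READ-G: the STABLE orbital integral at a regular point of the `G′`∕`G` Cartan atlas IS the slot-permutation sum of the chart functional, up to the positive frame mass of the
# chart box (N8-INNER brick (4), part II = `G`-side twin of ★ READ-H; Rogawski 1990 §4.1 (4.1.1), §4.3 (4.3.1), §14.2 (14.2.1); Shelstad 1979 §4)

Topic `NumberTheory/Rogawski1990`; namespace `Literature.NumberTheory.Rogawski1990`.  THEOREMS ONLY (no `def`, no instance, no notation, no axiom, no named fact, no `sorry`).  Cell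
`pub/hodgecm-mathlib`, crux H413 (`stmt-HodgeConjecture-24833`), F0∕P3c road «N8-INNER» (LEAD T14-4; row 2 `stub_N8`), brick (4) «READ-G» of the N8-ROAD-CENSUS v0 fd90e2d340c810dd
§2∕§5 (LH2-plan (g1) DEAL #1 2026-09-02T15:34:48Z; holder LH7-p01 (g7); ref5 R-725 «= FILE A §1–§3 true on paper»); SIGSHEET `F0/P3c/LH7/LH7-p01/g7/SIGSHEET-N8-brick4-ReadG.v1.LH7p01g7.md`
d6e741fda879bbc7.  PART II of two (part I ★ `ArchChartSlotPermStableClasses`: UNIQ-G′ `setOf_isStablyConj_out_eq_image_slotPerm`, the slot conjugator `exists_forall_conj_gprimeTorus_eq_slotPerm`,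
§0 `map_symm_eq_map_symm_of_transport`).  Count-neutral.

THE MATHEMATICS.  House frame `G′_∞ = U(diag α)(L⁺ ⊗ ℝ)`, `α_i ≠ 0`, `c(α_i) = α_i`; an admissible chart `S ⊆ splitChartPlaces L α`, `c ∈ RegG S`; `γ′ = gprimeTorus α S c` is regular
and `Z(γ′) = T_S` (★ `chartTorusG_eq_centralizer`); `γ′_ρ = gprimeTorus α S (slotPerm ρ c)`, `ρ ∈ partnerPerms S`.
* §2b The stable centraliser transport `e : Z(γ′) ≃ₜ* Z(γ′_ρ)` (★ `archStableCentralizerEquiv` along `γ′ ∼_st γ′_ρ`), read on `T_S` through the two presentations, IS the slot map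
  `gprimeTorus α S c₀ ↦ gprimeTorus α S (slotPerm ρ c₀)` (★ `coe_archStableCentralizerEquiv_eq_of_conj_eq` with part I's coordinate-free conjugator; canonical: two stable conjugators
  differ by the commutative `Z(γ′)`), whose sixth iterate is the identity (`S₃` has exponent `6`).
* §2c (SLOT COHERENCE OF THE FRAME MASS) In a Weil-form frame on `G′_∞` ((W′)+(C′) of ★ `ArchCompatibleFamiliesG`: `m′ = dν′∕dt′` at the regular classes, `t′` transported under
  stable conjugacy — the binders of ★ `classOrbitalIntegral_mul_measure_box_eq_chartOrbG` token for token), `t′(γ′_ρ)` and `t′(γ′)` read on `T_S` COINCIDE: (C′) makes the first the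
  push-forward of the second under the finite-order slot automorphism, `t′(γ′)` is a Haar measure on `Z(γ′)` (★ `atPoint_eq_quotientMeasure_of_isQuotientOf_of_archCoherent`), part I §0.
  **`map_subgroupCongr_symm_t'_gprimeTorus_slotPerm_eq`**; the box masses `M′(slotPerm ρ c) = M′(c) > 0` agree (★ `measure_chartBoxImgG_pos`).
* §3 (READ-G′ ∕ READ-G IN THE FRAME) **`stableOrbitalIntegralRel_gprimeTorus_mul_boxMass_eq_sum`**:
  `Φ^st_{m′}(γ′, f) · M′(c) = partnerWeight L α S · Σ_{ρ ∈ partnerPerms S} chartOrbG L α ν′ S f (slotPerm ρ c)` (★ `archStableOrbitalIntegral` = the closer's `Φ^st`) — part I UNIQ-G′ lists the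
  classes, ★ P3 passes to slot labels (`partnerWeight = ∏_{w ∉ S} (2 or 6)⁻¹`), each class term is the ★ junction at the regular point `slotPerm ρ c` (★ `slotPerm_mem_regG_iff`) with the
  slot-coherent mass of §2c.  Corollaries: the `archRG`-normalised form FORWARD (6) regroups ★ `orbFamG` with, and the identity solved for `Φ^st` (`M′(c) > 0`).  The `G`-side of the road is
  the instance `α := quasiSplitWeights` (★ `formCongr_quasiSplitFrame_diagonal`; every complex place a `(2,1)` place, `partnerWeight = 2^{−|univ∖S|}`), read on the `Φ₃` carrier through `Φ_Q`
  in the sequel `ArchChartBoxCoherenceInner` (brick (4) FILE B, with the (C′G) equality of the `G′`- and `G`-masses at partners); the re-spelling of the right side as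
  `stableSumG (slotSign L α) S (chartOrbG …) c` is one rewrite by brick (2)'s bridge (under its fibre-invariance hypothesis, ref5 R-725).
EDITION 2 (append-only, one import added): §3′ **`partnerWeight_mul_stableSumG_orbFamG_eq`** — the right side RE-SPELLED in the road's stable-sum currency ★ (2) `stableSumG` (LH10-p02 (g9),
★ `ArchStableSumG` ∕ the class-sum bridge ★ `stableSumG_eq_archRG_mul_sum` of p851944): `partnerWeight L α S · stableSumG (orbFamG ν′ f) S c = Φ^st_{m′}(gprimeTorus α S c, f) · M′(c) · archRG S c`
on `RegG S`, `S ⊆ splitChartPlaces` — the form FORWARD (6) ∕ the junction (11) read (dealer LH2-plan (g1) 15:46:22Z «consume FILE 1 by name»; ref5 R-725's fibre-invariance flag is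
discharged because the bridge is stated on the PLAIN partner sum).
HONEST LABEL: HC_CM is proved only modulo the 7 printed citations (2 remaining: hLiu418 = `stmt-HodgeConjecture-24832`, h413 = `stmt-HodgeConjecture-24833`) until rung 0 closes;
count-neutral until (Sh)′ is ★ and ED. 43 re-keys 27456 6 → 5.

## References
* [Rogawski1990] J. D. Rogawski, *Automorphic Representations of Unitary Groups in Three Variables*, Ann. of Math. Stud. 123 (1990), §4.1 (4.1.1) p. 39 (stable orbital integral =
  sum over the classes in the stable class), §4.3 (4.3.1) pp. 43–44 (compatible measures on the tori of a stable class), §14.2 (14.2.1) p. 232, §1.7 p. 6, §3.1 p. 19, §3.6 p. 31, §8.2 p. 122.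
* [Shelstad1979] D. Shelstad, *Characters and inner forms of a quasi-split group over ℝ*, Compositio Math. 39 (1979), §4 pp. 20–23 (`dt` transported along stable conjugacy; `R_T`,
  `Ψ^T_f`; Lemma 4.2).
* [Knapp1986] A. W. Knapp, *Representation Theory of Semisimple Groups* (1986), Ch. V §3 (Cartan subgroups; Weyl group action by permutation matrices).
* [DeitmarEchterhoff2014] A. Deitmar, S. Echterhoff, *Principles of Harmonic Analysis*, 2nd ed. (2014), Thm. 1.5.3.
* [Folland1995] G. B. Folland, *A Course in Abstract Harmonic Analysis* (1995), §2.2 (uniqueness of Haar measure; automorphisms act by a modulus).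
-/

set_option autoImplicit false

noncomputable section

open MeasureTheory MeasureTheory.Measure NumberField NumberField.InfinitePlace Matrix Complex Topology
open Literature.MeasureTheory.Group
open scoped MatrixGroups Matrix Classical NNReal ENNReal

/-! ## §2b–§2d The stable centraliser transport along a slot permutation is «permute the slots»; the frame mass of the chart box is slot-coherent -/

namespace Literature.NumberTheory.Rogawski1990

open Literature.NumberTheory.Automorphic Literature.NumberTheory.Automorphic.UnitaryGroup Literature.NumberTheory.Automorphic.ArchCartan

section Transport

variable (L : Type) [Field L] [NumberField L] [IsCMField L] (α : Fin 3 → L) (S : Finset {w : InfinitePlace L // IsComplex w})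
  (hd' : (Matrix.diagonal α).det ≠ 0) (hS : ∀ w, w ∈ S → w ∈ splitChartPlaces L α)
  {c : {w : InfinitePlace L // IsComplex w} → Fin 3 → ℝ} (hc : c ∈ ArchCartan.RegG S)
  {ρ : {w : InfinitePlace L // IsComplex w} → Equiv.Perm (Fin 3)} (hρ : ρ ∈ partnerPerms S)

/-- **THE SLOT TRANSPORT ON CHART POINTS**: for `ρ ∈ partnerPerms S` the stable centraliser transport `e : Z(γ′) ≃ₜ* Z(γ′_ρ)` (`γ′ = gprimeTorus α S c` regular, `γ′_ρ` its slot permutation)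
sends `z` with `↑z = gprimeTorus α S c₀` to `gprimeTorus α S (slotPerm ρ c₀)` — for EVERY `c₀` (★ `coe_archStableCentralizerEquiv_eq_of_conj_eq` with the coordinate-free conjugator of §2a;
the transport is canonical: two stable conjugators differ by the commutative `Z(γ′)`). [cite: Rogawski1990, §4.3 pp. 43–44] [cite: Shelstad1979, §4 p. 20] -/
theorem coe_archStableCentralizerEquiv_gprimeTorus_slotPerm_of_coe_eq
    (z : Subgroup.centralizer ({gprimeTorus L α S c} : Set ↥(arch (↥(maximalRealSubfield L)) L (IsCMField.complexConj L) 3 (Matrix.diagonal α))))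
    {c₀ : {w : InfinitePlace L // IsComplex w} → Fin 3 → ℝ}
    (hz : (z : ↥(arch (↥(maximalRealSubfield L)) L (IsCMField.complexConj L) 3 (Matrix.diagonal α))) = gprimeTorus L α S c₀) :
    ((archStableCentralizerEquiv L hd' hd' (corresponds_self_iff.2 (isStablyConj_gprimeTorus_slotPerm L α S hS hρ c))
        ((isRegularElt_gprimeTorus_iff_mem_regG L α S c hS).2 hc) z :
          Subgroup.centralizer ({gprimeTorus L α S (slotPerm ρ c)} : Set ↥(arch (↥(maximalRealSubfield L)) L (IsCMField.complexConj L) 3 (Matrix.diagonal α)))) :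
        ↥(arch (↥(maximalRealSubfield L)) L (IsCMField.complexConj L) 3 (Matrix.diagonal α))) =
      gprimeTorus L α S (slotPerm ρ c₀) := by
  obtain ⟨y, hy⟩ := exists_forall_conj_gprimeTorus_eq_slotPerm L α S hρ
  apply Subtype.ext
  rw [coe_archStableCentralizerEquiv_eq_of_conj_eq L hd' hd' (corresponds_self_iff.2 (isStablyConj_gprimeTorus_slotPerm L α S hS hρ c))
    ((isRegularElt_gprimeTorus_iff_mem_regG L α S c hS).2 hc) y (hy c), hz]
  exact hy c₀

/-- **READ ON THE CHART TORUS `T_S`** through the two presentations `hP₀ : T_S = Z(γ′)`, `hP : T_S = Z(γ′_ρ)`: the composite `T_S → Z(γ′) → Z(γ′_ρ) → T_S` is the slot map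
`gprimeTorus α S c₀ ↦ gprimeTorus α S (slotPerm ρ c₀)`. [cite: Rogawski1990, §4.3 pp. 43–44] -/
theorem subgroupCongr_symm_archStableCentralizerEquiv_subgroupCongr_gprimeTorus
    (hP₀ : chartTorusG L α S = Subgroup.centralizer ({gprimeTorus L α S c} : Set ↥(arch (↥(maximalRealSubfield L)) L (IsCMField.complexConj L) 3 (Matrix.diagonal α))))
    (hP : chartTorusG L α S = Subgroup.centralizer ({gprimeTorus L α S (slotPerm ρ c)} : Set ↥(arch (↥(maximalRealSubfield L)) L (IsCMField.complexConj L) 3 (Matrix.diagonal α))))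
    (c₀ : {w : InfinitePlace L // IsComplex w} → Fin 3 → ℝ) :
    (MulEquiv.subgroupCongr hP).symm
        (archStableCentralizerEquiv L hd' hd' (corresponds_self_iff.2 (isStablyConj_gprimeTorus_slotPerm L α S hS hρ c))
          ((isRegularElt_gprimeTorus_iff_mem_regG L α S c hS).2 hc)
          (MulEquiv.subgroupCongr hP₀ ⟨gprimeTorus L α S c₀, gprimeTorus_mem_chartTorusG L α S c₀⟩)) =
      ⟨gprimeTorus L α S (slotPerm ρ c₀), gprimeTorus_mem_chartTorusG L α S (slotPerm ρ c₀)⟩ := by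
  apply Subtype.ext
  rw [MulEquiv.subgroupCongr_symm_apply]
  exact coe_archStableCentralizerEquiv_gprimeTorus_slotPerm_of_coe_eq L α S hd' hS hc hρ _ (by rw [MulEquiv.subgroupCongr_apply])

/-- **Iterating the slot map**: the `k`-th iterate of `T_S → Z(γ′) → Z(γ′_ρ) → T_S` is the slot map of `ρ ^ k` (★ `slotPerm_mul`). [cite: Shelstad1979, Lemma 4.2 p. 23] -/
theorem iterate_subgroupCongr_symm_archStableCentralizerEquiv_gprimeTorus
    (hP₀ : chartTorusG L α S = Subgroup.centralizer ({gprimeTorus L α S c} : Set ↥(arch (↥(maximalRealSubfield L)) L (IsCMField.complexConj L) 3 (Matrix.diagonal α))))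
    (hP : chartTorusG L α S = Subgroup.centralizer ({gprimeTorus L α S (slotPerm ρ c)} : Set ↥(arch (↥(maximalRealSubfield L)) L (IsCMField.complexConj L) 3 (Matrix.diagonal α))))
    (k : ℕ) (c₀ : {w : InfinitePlace L // IsComplex w} → Fin 3 → ℝ) :
    (fun x : ↥(chartTorusG L α S) => (MulEquiv.subgroupCongr hP).symm
        (archStableCentralizerEquiv L hd' hd' (corresponds_self_iff.2 (isStablyConj_gprimeTorus_slotPerm L α S hS hρ c))
          ((isRegularElt_gprimeTorus_iff_mem_regG L α S c hS).2 hc) (MulEquiv.subgroupCongr hP₀ x)))^[k]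
        ⟨gprimeTorus L α S c₀, gprimeTorus_mem_chartTorusG L α S c₀⟩ =
      ⟨gprimeTorus L α S (slotPerm (ρ ^ k) c₀), gprimeTorus_mem_chartTorusG L α S (slotPerm (ρ ^ k) c₀)⟩ := by
  induction k with
  | zero =>
      apply Subtype.ext
      simp only [Function.iterate_zero, id_eq, pow_zero, slotPerm_one]
  | succ k ih =>
      rw [Function.iterate_succ_apply', ih, subgroupCongr_symm_archStableCentralizerEquiv_subgroupCongr_gprimeTorus L α S hd' hS hc hρ hP₀ hP]
      apply Subtype.ext
      show gprimeTorus L α S (slotPerm ρ (slotPerm (ρ ^ k) c₀)) = gprimeTorus L α S (slotPerm (ρ ^ (k + 1)) c₀)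
      rw [← slotPerm_mul, ← pow_succ]

/-- **The composite has order dividing `6`** (`S₃` has exponent `6`): its sixth iterate is the identity of `T_S`. [cite: Shelstad1979, Lemma 4.2 p. 23] -/
theorem iterate_six_subgroupCongr_symm_archStableCentralizerEquiv (hα : ∀ i, α i ≠ 0)
    (hP₀ : chartTorusG L α S = Subgroup.centralizer ({gprimeTorus L α S c} : Set ↥(arch (↥(maximalRealSubfield L)) L (IsCMField.complexConj L) 3 (Matrix.diagonal α))))
    (hP : chartTorusG L α S = Subgroup.centralizer ({gprimeTorus L α S (slotPerm ρ c)} : Set ↥(arch (↥(maximalRealSubfield L)) L (IsCMField.complexConj L) 3 (Matrix.diagonal α))))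
    (x : ↥(chartTorusG L α S)) :
    (fun x : ↥(chartTorusG L α S) => (MulEquiv.subgroupCongr hP).symm
        (archStableCentralizerEquiv L hd' hd' (corresponds_self_iff.2 (isStablyConj_gprimeTorus_slotPerm L α S hS hρ c))
          ((isRegularElt_gprimeTorus_iff_mem_regG L α S c hS).2 hc) (MulEquiv.subgroupCongr hP₀ x)))^[6] x = x := by
  have hx : (x : ↥(arch (↥(maximalRealSubfield L)) L (IsCMField.complexConj L) 3 (Matrix.diagonal α))) ∈
      Subgroup.centralizer ({gprimeTorus L α S c} : Set ↥(arch (↥(maximalRealSubfield L)) L (IsCMField.complexConj L) 3 (Matrix.diagonal α))) := hP₀ ▸ x.2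
  obtain ⟨c₀, hc₀⟩ := (mem_centralizer_gprimeTorus_iff L α S hα hS hc _).1 hx
  have hx' : x = ⟨gprimeTorus L α S c₀, gprimeTorus_mem_chartTorusG L α S c₀⟩ := Subtype.ext hc₀
  rw [hx', iterate_subgroupCongr_symm_archStableCentralizerEquiv_gprimeTorus L α S hd' hS hc hρ hP₀ hP 6 c₀]
  apply Subtype.ext
  show gprimeTorus L α S (slotPerm (ρ ^ 6) c₀) = gprimeTorus L α S c₀
  rw [slotPerms_pow_six, slotPerm_one]

end Transport

/-! ## §2c–§2d In a Weil-form frame the torus measures at `γ′` and `γ′_ρ` coincide on `T_S`; the box masses agree and are positive -/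

section Frame

variable (L : Type) [Field L] [NumberField L] [IsCMField L] (α : Fin 3 → L)
  [MeasurableSpace ↥(arch (↥(maximalRealSubfield L)) L (IsCMField.complexConj L) 3 (Matrix.diagonal α))] [BorelSpace ↥(arch (↥(maximalRealSubfield L)) L (IsCMField.complexConj L) 3 (Matrix.diagonal α))]
  (ν' : Measure ↥(arch (↥(maximalRealSubfield L)) L (IsCMField.complexConj L) 3 (Matrix.diagonal α))) [ν'.IsHaarMeasure] [ν'.IsMulRightInvariant]
  (S : Finset {w : InfinitePlace L // IsComplex w})
  -- orbit-quotient σ-algebras on `G′_∞` (binders; `borel` in the letter's frame)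
  [qGP : ∀ γ' : ↥(arch (↥(maximalRealSubfield L)) L (IsCMField.complexConj L) 3 (Matrix.diagonal α)), MeasurableSpace (↥(arch (↥(maximalRealSubfield L)) L (IsCMField.complexConj L) 3 (Matrix.diagonal α)) ⧸ Subgroup.centralizer ({γ'} : Set ↥(arch (↥(maximalRealSubfield L)) L (IsCMField.complexConj L) 3 (Matrix.diagonal α))))]
  [qbGP : ∀ γ' : ↥(arch (↥(maximalRealSubfield L)) L (IsCMField.complexConj L) 3 (Matrix.diagonal α)), BorelSpace (↥(arch (↥(maximalRealSubfield L)) L (IsCMField.complexConj L) 3 (Matrix.diagonal α)) ⧸ Subgroup.centralizer ({γ'} : Set ↥(arch (↥(maximalRealSubfield L)) L (IsCMField.complexConj L) 3 (Matrix.diagonal α))))]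
  (m' : OrbitalMeasureFamily ↥(arch (↥(maximalRealSubfield L)) L (IsCMField.complexConj L) 3 (Matrix.diagonal α)))
  (t' : ∀ γ' : ↥(arch (↥(maximalRealSubfield L)) L (IsCMField.complexConj L) 3 (Matrix.diagonal α)), Measure (Subgroup.centralizer ({γ'} : Set ↥(arch (↥(maximalRealSubfield L)) L (IsCMField.complexConj L) 3 (Matrix.diagonal α)))))
  (hd' : (Matrix.diagonal α).det ≠ 0)
  -- (W′)(C′) of ★ `ArchCompatibleFamiliesG` for the diagonal frame (the binders of ★ `classOrbitalIntegral_mul_measure_box_eq_chartOrbG`, token for token)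
  (hW' : m'.IsQuotientOf (fun γ => IsRegularElt (γ.val : GL (Fin 3) (mixedEmbedding.mixedSpace L))) ν' t')
  (hC' : ∀ (γ₁ γ₂ : ↥(arch (↥(maximalRealSubfield L)) L (IsCMField.complexConj L) 3 (Matrix.diagonal α))) (h₁ : IsRegularElt (γ₁.val : GL (Fin 3) (mixedEmbedding.mixedSpace L)))
      (hc : Corresponds (UnitaryGroup.conjMixed (↥(maximalRealSubfield L)) L (IsCMField.complexConj L))
        (UnitaryGroup.archFormOf L 3 (Matrix.diagonal α)) (UnitaryGroup.archFormOf L 3 (Matrix.diagonal α)) γ₁ γ₂),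
      Measure.map ⇑(UnitaryGroup.archStableCentralizerEquiv L hd' hd' hc h₁) (t' γ₁) = t' γ₂)

include hW' hC' in
/-- **SLOT COHERENCE OF THE TORUS MEASURE (the `hbox` of READ-G′), in measure form.**  In a Weil-form frame ((W′)+(C′)), for `c ∈ RegG S` (`S ⊆ splitChartPlaces`) and
`ρ ∈ partnerPerms S`, the torus measures `t′(gprimeTorus α S (slotPerm ρ c))` and `t′(gprimeTorus α S c)`, read on the common centraliser `T_S` through the two presentations, ARE EQUAL:
(C′) along `γ′ ↔ γ′_ρ` makes the first the push-forward of the second under the slot automorphism `Ψ_ρ` of `T_S` (§2b), of order dividing `6`; `t′(γ′)` is a Haar measure on `Z(γ′)`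
(★ `atPoint_eq_quotientMeasure_of_isQuotientOf_of_archCoherent`), and finite-order automorphisms preserve Haar measures (§0). [cite: Rogawski1990, §1.7 p. 6; §4.3 (4.3.1) pp. 43–44]
[cite: Shelstad1979, §4 p. 20] [cite: Folland1995, §2.2] -/
theorem map_subgroupCongr_symm_t'_gprimeTorus_slotPerm_eq (hα : ∀ i, α i ≠ 0) (hS : ∀ w, w ∈ S → w ∈ splitChartPlaces L α)
    {c : {w : InfinitePlace L // IsComplex w} → Fin 3 → ℝ} (hc : c ∈ ArchCartan.RegG S)
    {ρ : {w : InfinitePlace L // IsComplex w} → Equiv.Perm (Fin 3)} (hρ : ρ ∈ partnerPerms S)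
    (hP₀ : chartTorusG L α S = Subgroup.centralizer ({gprimeTorus L α S c} : Set ↥(arch (↥(maximalRealSubfield L)) L (IsCMField.complexConj L) 3 (Matrix.diagonal α))))
    (hP : chartTorusG L α S = Subgroup.centralizer ({gprimeTorus L α S (slotPerm ρ c)} : Set ↥(arch (↥(maximalRealSubfield L)) L (IsCMField.complexConj L) 3 (Matrix.diagonal α)))) :
    (t' (gprimeTorus L α S (slotPerm ρ c))).map ⇑(MulEquiv.subgroupCongr hP).symm = (t' (gprimeTorus L α S c)).map ⇑(MulEquiv.subgroupCongr hP₀).symm := by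
  have hreg : IsRegularElt ((gprimeTorus L α S c).val : GL (Fin 3) (mixedEmbedding.mixedSpace L)) := (isRegularElt_gprimeTorus_iff_mem_regG L α S c hS).2 hc
  have hcorr : Corresponds (UnitaryGroup.conjMixed (↥(maximalRealSubfield L)) L (IsCMField.complexConj L))
      (UnitaryGroup.archFormOf L 3 (Matrix.diagonal α)) (UnitaryGroup.archFormOf L 3 (Matrix.diagonal α)) (gprimeTorus L α S c) (gprimeTorus L α S (slotPerm ρ c)) :=
    corresponds_self_iff.2 (isStablyConj_gprimeTorus_slotPerm L α S hS hρ c)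
  -- `t′(γ′)` is a Haar measure (frame)
  obtain ⟨i1, -, -⟩ := atPoint_eq_quotientMeasure_of_isQuotientOf_of_archCoherent L hd' hW' hC' _ hreg
  haveI := i1
  haveI := locallyCompactSpace_chartTorusG L α S
  have csc₀ : Continuous ⇑(MulEquiv.subgroupCongr hP₀) := continuous_subtype_val.subtype_mk _
  have csc₀s : Continuous ⇑(MulEquiv.subgroupCongr hP₀).symm := continuous_subtype_val.subtype_mk _
  have csc : Continuous ⇑(MulEquiv.subgroupCongr hP) := continuous_subtype_val.subtype_mk _
  have cscs : Continuous ⇑(MulEquiv.subgroupCongr hP).symm := continuous_subtype_val.subtype_mk _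
  exact map_symm_eq_map_symm_of_transport (MulEquiv.subgroupCongr hP₀) csc₀ csc₀s (MulEquiv.subgroupCongr hP) csc cscs
    (UnitaryGroup.archStableCentralizerEquiv L hd' hd' hcorr hreg) (t' (gprimeTorus L α S c)) (t' (gprimeTorus L α S (slotPerm ρ c))) (hC' _ _ hreg hcorr)
    (by norm_num : (6 : ℕ) ≠ 0) (iterate_six_subgroupCongr_symm_archStableCentralizerEquiv L α S hd' hS hc hρ hα hP₀ hP)

include hW' hC' in
/-- **The `hbox` of READ-G′, discharged**: the frame mass of the chart box is the same number at every slot-permuted chart point (★ `image_slotPerm_chartBox`: the box is slot-stable, so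
both masses are read on the same set `B′_S` of `T_S`). [cite: Rogawski1990, §4.3 (4.3.1) pp. 43–44] [cite: Shelstad1979, §4 p. 20] -/
theorem toReal_map_t'_gprimeTorus_slotPerm_chartBoxImgG_eq (hα : ∀ i, α i ≠ 0) (hS : ∀ w, w ∈ S → w ∈ splitChartPlaces L α)
    {c : {w : InfinitePlace L // IsComplex w} → Fin 3 → ℝ} (hc : c ∈ ArchCartan.RegG S)
    {ρ : {w : InfinitePlace L // IsComplex w} → Equiv.Perm (Fin 3)} (hρ : ρ ∈ partnerPerms S)
    (hP₀ : chartTorusG L α S = Subgroup.centralizer ({gprimeTorus L α S c} : Set ↥(arch (↥(maximalRealSubfield L)) L (IsCMField.complexConj L) 3 (Matrix.diagonal α))))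
    (hP : chartTorusG L α S = Subgroup.centralizer ({gprimeTorus L α S (slotPerm ρ c)} : Set ↥(arch (↥(maximalRealSubfield L)) L (IsCMField.complexConj L) 3 (Matrix.diagonal α)))) :
    ((t' (gprimeTorus L α S (slotPerm ρ c))).map ⇑(MulEquiv.subgroupCongr hP).symm (chartBoxImgG L α S)).toReal =
      ((t' (gprimeTorus L α S c)).map ⇑(MulEquiv.subgroupCongr hP₀).symm (chartBoxImgG L α S)).toReal := by
  rw [map_subgroupCongr_symm_t'_gprimeTorus_slotPerm_eq L α ν' S m' t' hd' hW' hC' hα hS hc hρ hP₀ hP]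

include hW' hC' in
/-- **The box mass `M′(c)` is positive** (a Haar measure of a compact set with nonempty interior: ★ `measure_chartBoxImgG_pos`, ★ `isCompact_chartBoxImgG`). [cite: Rogawski1990, §1.7 p. 6]
[cite: Folland1995, §2.2] -/
theorem toReal_map_t'_gprimeTorus_chartBoxImgG_pos (hα : ∀ i, α i ≠ 0) (hS : ∀ w, w ∈ S → w ∈ splitChartPlaces L α)
    {c : {w : InfinitePlace L // IsComplex w} → Fin 3 → ℝ} (hc : c ∈ ArchCartan.RegG S)
    (hP₀ : chartTorusG L α S = Subgroup.centralizer ({gprimeTorus L α S c} : Set ↥(arch (↥(maximalRealSubfield L)) L (IsCMField.complexConj L) 3 (Matrix.diagonal α)))) :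
    0 < ((t' (gprimeTorus L α S c)).map ⇑(MulEquiv.subgroupCongr hP₀).symm (chartBoxImgG L α S)).toReal := by
  have hreg : IsRegularElt ((gprimeTorus L α S c).val : GL (Fin 3) (mixedEmbedding.mixedSpace L)) := (isRegularElt_gprimeTorus_iff_mem_regG L α S c hS).2 hc
  obtain ⟨i1, -, -⟩ := atPoint_eq_quotientMeasure_of_isQuotientOf_of_archCoherent L hd' hW' hC' _ hreg
  haveI := i1
  haveI := locallyCompactSpace_chartTorusG L α S
  have csc₀ : Continuous ⇑(MulEquiv.subgroupCongr hP₀) := continuous_subtype_val.subtype_mk _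
  have csc₀s : Continuous ⇑(MulEquiv.subgroupCongr hP₀).symm := continuous_subtype_val.subtype_mk _
  haveI : (Measure.map ⇑(MulEquiv.subgroupCongr hP₀).symm (t' (gprimeTorus L α S c))).IsHaarMeasure :=
    (MulEquiv.subgroupCongr hP₀).symm.isHaarMeasure_map _ csc₀s csc₀
  exact ENNReal.toReal_pos (measure_chartBoxImgG_pos L α S hα hS _).ne' (isCompact_chartBoxImgG L α S).measure_lt_top.ne

/-! ## §3 READ-G′ ∕ READ-G in the frame: the stable orbital integral at a chart point IS the slot-permutation sum, up to the positive box mass `M′(c)` -/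

include hW' hC' in
/-- **READ-G′ (and READ-G at `α := quasiSplitWeights`), UNCONDITIONAL IN THE FRAME**: for a Weil-form frame on `G′_∞ = U(diag α)(L⁺ ⊗ ℝ)` ((W′)+(C′)), `c(α_i) = α_i ≠ 0`, `S ⊆ splitChartPlaces`,
`c ∈ RegG S`:
`Φ^st_{m′}(gprimeTorus α S c, f) · M′(c) = partnerWeight L α S · Σ_{ρ ∈ partnerPerms S} chartOrbG ν′ S f (slotPerm ρ c)`,
`M′(c) > 0` the frame mass of the chart box — UNIQ-G′ (§1) lists the classes, ★ P3 passes from classes to slot labels (`partnerWeight = ∏_{w ∉ S} (2 or 6)⁻¹`), each class term is the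
★ junction `classOrbitalIntegral_mul_measure_box_eq_chartOrbG` at the regular point `slotPerm ρ c` with the slot-coherent mass (§2c).  Print: `Φ^st(γ, f) = Σ_{γ′ ∼_st γ} Φ(γ′, f)` with
compatible measures `dt` on the tori of the stable class. [cite: Rogawski1990, §4.1 (4.1.1) p. 39; §4.3 (4.3.1) pp. 43–44; §14.2 (14.2.1) p. 232] [cite: Shelstad1979, §4 pp. 20–23, Lemma 4.2]
[cite: DeitmarEchterhoff2014, Thm. 1.5.3] -/
theorem stableOrbitalIntegralRel_gprimeTorus_mul_boxMass_eq_sum (hα : ∀ i, α i ≠ 0) (hherm : ∀ i, (IsCMField.complexConj L (α i) : L) = α i)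
    (hS : ∀ w, w ∈ S → w ∈ splitChartPlaces L α) {c : {w : InfinitePlace L // IsComplex w} → Fin 3 → ℝ} (hc : c ∈ ArchCartan.RegG S)
    (f : ↥(arch (↥(maximalRealSubfield L)) L (IsCMField.complexConj L) 3 (Matrix.diagonal α)) → ℂ) :
    archStableOrbitalIntegral L 3 (Matrix.diagonal α) m' f (gprimeTorus L α S c) *
        (((t' (gprimeTorus L α S c)).map ⇑(MulEquiv.subgroupCongr (chartTorusG_eq_centralizer L α S hα hS hc)).symm (chartBoxImgG L α S)).toReal : ℂ) =
      partnerWeight L α S * ∑ ρ ∈ partnerPerms S, chartOrbG L α ν' S f (slotPerm ρ c) := by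
  have h1 : archStableOrbitalIntegral L 3 (Matrix.diagonal α) m' f (gprimeTorus L α S c) =
      partnerWeight L α S * ∑ ρ ∈ partnerPerms S, classOrbitalIntegral m' f (ConjClasses.mk (gprimeTorus L α S (slotPerm ρ c))) :=
    finsum_mem_setOf_isStablyConj_out_eq_partnerWeight_mul_sum L α S hα hherm hS hc (classOrbitalIntegral m' f)
  rw [h1, mul_assoc, Finset.sum_mul]
  congr 1
  refine Finset.sum_congr rfl fun ρ hρ => ?_
  have hcρ : slotPerm ρ c ∈ ArchCartan.RegG S := (slotPerm_mem_regG_iff hρ c).2 hc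
  rw [← classOrbitalIntegral_mul_measure_box_eq_chartOrbG L α ν' S m' t' hd' hW' hC' hα hS hcρ f,
    toReal_map_t'_gprimeTorus_slotPerm_chartBoxImgG_eq L α ν' S m' t' hd' hW' hC' hα hS hc hρ (chartTorusG_eq_centralizer L α S hα hS hc) (chartTorusG_eq_centralizer L α S hα hS hcρ)]

include hW' hC' in
/-- **The same in the `R′`-normalised family currency** (★ `orbFamG = archRG · chartOrbG` on admissible labels): `Φ^st_{m′}(gprimeTorus α S c, f) · M′(c) · archRG S c` is `partnerWeight` times
the slot sum of `archRG S c · chartOrbG … (slotPerm ρ c)` — the form FORWARD (6) reads when it regroups ★ `orbFamG` by stable classes (`archRG` is evaluated at `c`; its slot-symmetry is the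
consumer's ★ (W)-clause, not used here). [cite: Rogawski1990, §4.1 (4.1.1) p. 39; §4.3 (4.3.1) p. 43] [cite: Shelstad1979, §4 p. 22] -/
theorem stableOrbitalIntegralRel_gprimeTorus_mul_boxMass_mul_archRG_eq_sum (hα : ∀ i, α i ≠ 0) (hherm : ∀ i, (IsCMField.complexConj L (α i) : L) = α i)
    (hS : ∀ w, w ∈ S → w ∈ splitChartPlaces L α) {c : {w : InfinitePlace L // IsComplex w} → Fin 3 → ℝ} (hc : c ∈ ArchCartan.RegG S)
    (f : ↥(arch (↥(maximalRealSubfield L)) L (IsCMField.complexConj L) 3 (Matrix.diagonal α)) → ℂ) :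
    archStableOrbitalIntegral L 3 (Matrix.diagonal α) m' f (gprimeTorus L α S c) *
        (((t' (gprimeTorus L α S c)).map ⇑(MulEquiv.subgroupCongr (chartTorusG_eq_centralizer L α S hα hS hc)).symm (chartBoxImgG L α S)).toReal : ℂ) * archRG S c =
      partnerWeight L α S * ∑ ρ ∈ partnerPerms S, archRG S c * chartOrbG L α ν' S f (slotPerm ρ c) := by
  have h := stableOrbitalIntegralRel_gprimeTorus_mul_boxMass_eq_sum L α ν' S m' t' hd' hW' hC' hα hherm hS hc f
  rw [h, mul_assoc, Finset.sum_mul]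
  exact congrArg _ (Finset.sum_congr rfl fun ρ _ => mul_comm _ _)

include hW' hC' in
/-- **READ-G′ solved for the stable orbital integral** (`M′(c) > 0`): `Φ^st_{m′}(gprimeTorus α S c, f) = M′(c)⁻¹ · partnerWeight · Σ_ρ chartOrbG … (slotPerm ρ c)`.
[cite: Rogawski1990, §4.1 (4.1.1) p. 39; §14.2 (14.2.1) p. 232] [cite: Shelstad1979, §4 p. 20] -/
theorem stableOrbitalIntegralRel_gprimeTorus_eq_inv_boxMass_mul_sum (hα : ∀ i, α i ≠ 0) (hherm : ∀ i, (IsCMField.complexConj L (α i) : L) = α i)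
    (hS : ∀ w, w ∈ S → w ∈ splitChartPlaces L α) {c : {w : InfinitePlace L // IsComplex w} → Fin 3 → ℝ} (hc : c ∈ ArchCartan.RegG S)
    (f : ↥(arch (↥(maximalRealSubfield L)) L (IsCMField.complexConj L) 3 (Matrix.diagonal α)) → ℂ) :
    archStableOrbitalIntegral L 3 (Matrix.diagonal α) m' f (gprimeTorus L α S c) =
      ((((t' (gprimeTorus L α S c)).map ⇑(MulEquiv.subgroupCongr (chartTorusG_eq_centralizer L α S hα hS hc)).symm (chartBoxImgG L α S)).toReal : ℂ))⁻¹ *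
        (partnerWeight L α S * ∑ ρ ∈ partnerPerms S, chartOrbG L α ν' S f (slotPerm ρ c)) := by
  have hM : (((t' (gprimeTorus L α S c)).map ⇑(MulEquiv.subgroupCongr (chartTorusG_eq_centralizer L α S hα hS hc)).symm (chartBoxImgG L α S)).toReal : ℂ) ≠ 0 :=
    Complex.ofReal_ne_zero.2 (toReal_map_t'_gprimeTorus_chartBoxImgG_pos L α ν' S m' t' hd' hW' hC' hα hS hc _).ne'
  rw [← stableOrbitalIntegralRel_gprimeTorus_mul_boxMass_eq_sum L α ν' S m' t' hd' hW' hC' hα hherm hS hc f, mul_comm, mul_assoc, mul_inv_cancel₀ hM, mul_one]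

/-! ## §3′ (EDITION 2) The READ identity in the stable-sum currency of brick (2) -/

include hW' hC' in
/-- **READ-G′ IN `stableSumG` CURRENCY** (EDITION 2): for `c ∈ RegG S`, `S ⊆ splitChartPlaces`,
`partnerWeight L α S · stableSumG (orbFamG ν′ f) S c = Φ^st_{m′}(gprimeTorus α S c, f) · M′(c) · archRG S c` — ★ (2) `stableSumG_eq_archRG_mul_sum` (the family is `R′`-normalised on the
partner points, ★ `orbFamG_apply`) + §3 `stableOrbitalIntegralRel_gprimeTorus_mul_boxMass_mul_archRG_eq_sum`.  This is the seam FORWARD (6) and the junction (11) read: the chart STABLE family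
of `f` at a regular chart point is, up to the positive scalar `M′(c) ∕ partnerWeight`, `R′(c)` times the closer's stable orbital integral. [cite: Rogawski1990, §4.1 (4.1.1) p. 39; §4.3 (4.3.1) p. 43;
§14.2 (14.2.1) p. 232] [cite: Shelstad1979, §4 p. 22, Lemma 4.2 p. 23] -/
theorem partnerWeight_mul_stableSumG_orbFamG_eq (hα : ∀ i, α i ≠ 0) (hherm : ∀ i, (IsCMField.complexConj L (α i) : L) = α i)
    (hS : ∀ w, w ∈ S → w ∈ splitChartPlaces L α) {c : {w : InfinitePlace L // IsComplex w} → Fin 3 → ℝ} (hc : c ∈ ArchCartan.RegG S)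
    (f : ↥(arch (↥(maximalRealSubfield L)) L (IsCMField.complexConj L) 3 (Matrix.diagonal α)) → ℂ) :
    partnerWeight L α S * stableSumG (orbFamG L α ν' f) S c =
      archStableOrbitalIntegral L 3 (Matrix.diagonal α) m' f (gprimeTorus L α S c) *
        (((t' (gprimeTorus L α S c)).map ⇑(MulEquiv.subgroupCongr (chartTorusG_eq_centralizer L α S hα hS hc)).symm (chartBoxImgG L α S)).toReal : ℂ) * archRG S c := by
  rw [stableOrbitalIntegralRel_gprimeTorus_mul_boxMass_mul_archRG_eq_sum L α ν' S m' t' hd' hW' hC' hα hherm hS hc f,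
    stableSumG_eq_archRG_mul_sum (Φ := chartOrbG L α ν' S f) (fun ρ _ => orbFamG_apply L α ν' f hS (slotPerm ρ c)), Finset.mul_sum, Finset.mul_sum]

end Frame

end Literature.NumberTheory.Rogawski1990

end
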